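import Literature.NumberTheory.DiophantineGeometry.GenEllDeCoverFarFromCuspsMechanism
import Literature.NumberTheory.DiophantineGeometry.GenEllDeRamificationPadicFamily
import Literature.NumberTheory.DiophantineGeometry.GenEllDeRamificationArchFamily
import Literature.NumberTheory.DiophantineGeometry.GenEllDeCriticalValuesFamily
import Literature.NumberTheory.DiophantineGeometry.FibreConductorBadPlaces
import HarnessLib

/-!
# [GenEll] Thm. 2.1 on the `D_e` route, family `t_c`: separation of the ramification form `N_c` at `2`
# and at `∞` from the farness of `x` from the roots of the mechanism's bad polynomial `g`

S. Mochizuki, *Arithmetic elliptic curves in general position*, Math. J. Okayama Univ. **52** (2010), proof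
of Thm. 2.1 p. 12 (the compactly bounded subset attached to a noncritical Belyi map)
[cite: MochizukiGenEll2010, Thm 2.1 proof p.12]. Junction file (proof-only) for the abc-iut cell's route
item `GenEllTwo` (stmt-ABC-19679), the NFPoint layer of «GenEllMechanismKappa»: the conductor slope
(`DeC.slope_sep_two_of_splits`) takes the analytic inputs `hsep` (a uniform lower bound on `‖σ N_c‖` over
the `2`-adic embeddings `σ`) and `harch` (the same at the infinite places). The mechanism assembly
(abc-iut-w5-d075) supplies, for the bad polynomial `g = Res_r(curve, G_{pq(p−q)})`, that every conjugate
of `x` is `ρ`-far from the roots of `g` in `ℂ` and in `Q̄₂`. This file turns that into `hsep`/`harch`: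

* `DeCrit.aeval_tCritC_eq_zero_transfer` — «critical values ↦ cusps» transfers from `ℂ` to EVERY field
  of characteristic zero (through the number field `ℚ(θ)` of a root `θ` of `R_c`);
* `DeFamily.fst_mem_aroots_resultant_of_N_eq_zero` — hence over every algebraically closed field of
  characteristic zero the `x`-coordinate of a zero of `N_c` on `D_e` is a root of `g`
  (abc-iut-w4-d031's `De.fst_mem_aroots_resultant_of_fibre`);
* `DeFamily.exists_k2_of_far_aroots_two` — `hsep` at `2` (over abc-iut-w5-d055's
  `exists_pos_le_norm_embedding_of_separated_of_subset`; the constant depends on a DEGREE BOUND on the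
  field, as that lemma does);
* `DeFamily.exists_C3_of_far_aroots_arch` — `harch` (over abc-iut-w5-d027's
  `exists_pos_le_norm_N_of_fst_separated`; no degree bound).

Classical; nothing here bears on [IUTchIII] Cor. 3.12.
-/

noncomputable section

open Polynomial NumberField
open scoped Classical

namespace Literature.NumberTheory.DiophantineGeometry.GenEll

/-! ## Transfer of «critical values ↦ cusps» from `ℂ` to any field of characteristic zero -/

namespace DeCrit

open IntermediateField in

/-- **Transfer.** If `m ∈ ℚ[X]` vanishes at `tCritC c θ` for every COMPLEX root `θ` of `R_c`, then it
vanishes at `tCritC c θ` for every root `θ` of `R_c` in ANY field `Ω` of characteristic zero (embed the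
number field `ℚ(θ) ⊆ Ω` into `ℂ`; `tCritC` commutes with field maps).
[cite: MochizukiGenEll2010, Thm 2.1 proof p.12] -/
theorem aeval_tCritC_eq_zero_transfer (k : ℕ) (c : ℚ) (m : ℚ[X])
    (hℂ : ∀ θ : ℂ, (RpolyC k (c : ℂ)).eval θ = 0 → aeval (tCritC k (c : ℂ) θ) m = 0)
    {Ω : Type*} [Field Ω] [CharZero Ω] (θ : Ω) (hθ : (RpolyC k (c : Ω)).eval θ = 0) :
    aeval (tCritC k (c : Ω) θ) m = 0 := by
  -- the number field `F = ℚ(θ) ⊆ Ω`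
  have hθint : IsIntegral ℚ θ := isIntegral_of_eval_RpolyC hθ
  set F : IntermediateField ℚ Ω := ℚ⟮θ⟯ with hF
  haveI : FiniteDimensional ℚ F := IntermediateField.adjoin.finiteDimensional hθint
  haveI : NumberField F := NumberField.mk
  let θF : F := ⟨θ, IntermediateField.mem_adjoin_simple_self ℚ θ⟩
  have hθF_coe : (algebraMap F Ω) θF = θ := rfl
  -- `θF` is a root of `R_c` in `F`
  have hθF : (RpolyC k (c : F)).eval θF = 0 := by
    apply (algebraMap F Ω).injective
    rw [map_zero, ← eval_RpolyC_map, map_ratCast, hθF_coe, hθ]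
  -- embed `F` into `ℂ` and read the hypothesis there
  let τ : F →ₐ[ℚ] ℂ := IsAlgClosed.lift
  have hτθ : (RpolyC k (c : ℂ)).eval (τ θF) = 0 := by
    have h := eval_RpolyC_map (τ : F →+* ℂ) k (c : F) θF
    simp only [RingHom.coe_coe, map_ratCast] at h
    rw [h, hθF, map_zero]
  have hℂ' := hℂ (τ θF) hτθ
  have hτt : τ (tCritC k (c : F) θF) = tCritC k (c : ℂ) (τ θF) := by
    have h2 := map_tCritC (τ : F →+* ℂ) k (c : F) θF
    simp only [RingHom.coe_coe, map_ratCast] at h2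
    exact h2
  have hF0 : aeval (tCritC k (c : F) θF) m = 0 := by
    apply (τ : F →+* ℂ).injective
    rw [map_zero]
    have h := Polynomial.aeval_algHom_apply τ (tCritC k (c : F) θF) m
    rw [RingHom.coe_coe, ← h, hτt, hℂ']
  -- and push down to `Ω`
  have hΩt : tCritC k (c : Ω) θ = algebraMap F Ω (tCritC k (c : F) θF) := by
    rw [map_tCritC (algebraMap F Ω), map_ratCast, hθF_coe]
  rw [hΩt, Polynomial.aeval_algebraMap_apply, hF0, map_zero]

/-- The same from the hypothesis «`m` vanishes on `critSetC k c`» (the critical VALUES, the form the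
mechanism's Belyi map supplies: critical values ↦ cusps). [cite: MochizukiGenEll2010, Thm 2.1 proof p.12] -/
theorem aeval_tCritC_eq_zero_of_critSetC (k : ℕ) (c : ℚ) (m : ℚ[X])
    (hm : ∀ a ∈ critSetC k c, aeval a m = 0)
    {Ω : Type*} [Field Ω] [CharZero Ω] (θ : Ω) (hθ : (RpolyC k (c : Ω)).eval θ = 0) :
    aeval (tCritC k (c : Ω) θ) m = 0 :=
  aeval_tCritC_eq_zero_transfer k c m
    (fun θ' hθ' => hm _ (mem_critSetC_iff.mpr ⟨θ', hθ', rfl⟩)) θ hθ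

end DeCrit


/-! ## Zeros of `N_c` have `x`-coordinate among the roots of the bad polynomial `g` -/

namespace DeFamily

section AlgClosed

variable {Ω : Type*} [Field Ω] [CharZero Ω] [IsAlgClosed Ω]

/-- Over every algebraically closed field `Ω` of characteristic zero: if the mechanism's cusp polynomial
`p·q·(p − q)` vanishes on the critical values of `t_c` (in `ℂ`), then the `x`-coordinate of every zero
of `N_c` on `D_e(Ω)` is a root of `g = Res_r(curve, G_{pq(p−q)})` (abc-iut-w4-d031's
`De.fst_mem_aroots_resultant_of_fibre` at the critical value, transported by
`DeCrit.aeval_tCritC_eq_zero_of_critSetC`). [cite: MochizukiGenEll2010, Thm 2.1 proof p.12] -/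
theorem fst_mem_aroots_resultant_of_N_eq_zero (k : ℕ) {c : ℚ} (hc : c ≠ 0) {p q : ℚ[X]}
    (hp0 : p ≠ 0) (hq0 : q ≠ 0) (hne : p ≠ q)
    (hm : ∀ a ∈ DeCrit.critSetC k c, aeval a (p * q * (p - q)) = 0)
    (Q : Ω × Ω) (hcurve : Q.2 ^ (2 * k + 1) = Q.1 * (1 - Q.1)) (hN : N k (c : Ω) Q = 0) :
    Q.1 ∈ (resultant (De.curvePoly k) (De.homFibrePolyC k c (p * q * (p - q)))).aroots Ω := by
  have hc' : (c : Ω) ≠ 0 := Rat.cast_ne_zero.mpr hc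
  have hNv : DeCrit.NvalC k (c : Ω) Q = 0 := by
    rw [← hN]; simp [DeCrit.NvalC, DeCrit.alpha, N]
  obtain ⟨hr, hs⟩ := DeCrit.snd_ne_zero_and_one_sub_two_mul_ne_zero_of_NvalC hc' hcurve hNv
  have hθ : (DeCrit.RpolyC k (c : Ω)).eval Q.2 = 0 :=
    DeCrit.eval_RpolyC_eq_zero_of_NvalC_eq_zero k (c : Ω) hcurve hNv
  have ht : DeCrit.tC k (c : Ω) Q.1 Q.2 = DeCrit.tCritC k (c : Ω) Q.2 := DeCrit.tC_eq_tCritC hc' hcurve hNv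
  have hval : aeval (DeCrit.tC k (c : Ω) Q.1 Q.2) (p * q * (p - q)) = 0 := by
    rw [ht]; exact DeCrit.aeval_tCritC_eq_zero_of_critSetC k c _ hm Q.2 hθ
  have hcΩ : algebraMap ℚ Ω c = (c : Ω) := eq_ratCast _ _
  refine De.fst_mem_aroots_resultant_of_fibre k hc hp0 hq0 hne Q hcurve hr hs ?_
  rw [hcΩ]
  change aeval (DeCrit.tC k (c : Ω) Q.1 Q.2) p = 0 ∨ aeval (DeCrit.tC k (c : Ω) Q.1 Q.2) q = 0 ∨
    aeval (DeCrit.tC k (c : Ω) Q.1 Q.2) (p - q) = 0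
  rw [map_mul, map_mul] at hval
  rcases mul_eq_zero.mp hval with h | h
  · rcases mul_eq_zero.mp h with h' | h'
    · exact Or.inl h'
    · exact Or.inr (Or.inl h')
  · exact Or.inr (Or.inr h)

end AlgClosed

/-! ## `hsep` at `2` and `harch` from farness of `x` from the roots of `g` -/

section Separation

/-- **`hsep` at `2`.** For the mechanism `(c, p, q)` with `p·q·(p−q)` vanishing on the critical values and
every `ρ > 0` and degree bound `dL`, there is `k₂ : ℕ` such that for every number field `L` of degree
`≤ dL`, every point `(x, r)` of `D_e(L)` all of whose `2`-adic conjugates of `x` are `ρ`-far from the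
roots of `g`, and every `σ : L → Q̄₂`: `(2^{k₂})⁻¹ ≤ ‖σ N_c(x, r)‖` (abc-iut-w5-d055's
separation lemma; the degree bound is inherited from it). [cite: MochizukiGenEll2010, Thm 2.1 proof p.12] -/
theorem exists_k2_of_far_aroots_two (k dL : ℕ) {c : ℚ} (hc : c ≠ 0) {p q : ℚ[X]}
    (hp0 : p ≠ 0) (hq0 : q ≠ 0) (hne : p ≠ q)
    (hm : ∀ a ∈ DeCrit.critSetC k c, aeval a (p * q * (p - q)) = 0) {ρ : ℝ} (hρ : 0 < ρ) :
    ∃ k₂ : ℕ, ∀ (L : Type) [Field L] [NumberField L], Module.finrank ℚ L ≤ dL →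
      ∀ (x r : L), r ^ (2 * k + 1) = x * (1 - x) →
      (∀ σ : L →+* PadicAlgCl 2, ∀ a ∈ (resultant (De.curvePoly k)
        (De.homFibrePolyC k c (p * q * (p - q)))).aroots (PadicAlgCl 2), ρ < ‖σ x - a‖) →
      ∀ σ : L →+* PadicAlgCl 2,
        ((2 : ℝ) ^ k₂)⁻¹ ≤
          ‖σ (-(1 - 2 * x) ^ 3 + (c : L) * (((k : L) + 1) * r ^ (k + 2) - 2 * r ^ (3 * k + 3)))‖ := by
  obtain ⟨c₀, hc₀, hsep⟩ :=
    DePadicC.exists_pos_le_norm_embedding_of_separated_of_subset 2 k dL hc hρ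
  obtain ⟨k₂, hk₂⟩ := FibreConductor.exists_pow_inv_le 2 hc₀
  refine ⟨k₂, fun L _ _ hdeg x r hcurve hfar σ => ?_⟩
  -- the separation set: points of the curve whose `x`-coordinate is a root of `g`
  let Z : Set (PadicAlgCl 2 × PadicAlgCl 2) := {Q | Q.2 ^ (2 * k + 1) = Q.1 * (1 - Q.1) ∧
    Q.1 ∈ (resultant (De.curvePoly k) (De.homFibrePolyC k c (p * q * (p - q)))).aroots (PadicAlgCl 2)}
  have hZ : ∀ Q : PadicAlgCl 2 × PadicAlgCl 2, Q.2 ^ (2 * k + 1) = Q.1 * (1 - Q.1) →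
      -(1 - 2 * Q.1) ^ 3 + (c : PadicAlgCl 2) *
        (((k : PadicAlgCl 2) + 1) * Q.2 ^ (k + 2) - 2 * Q.2 ^ (3 * k + 3)) = 0 → Q ∈ Z :=
    fun Q hQ hN => ⟨hQ, fst_mem_aroots_resultant_of_N_eq_zero k hc hp0 hq0 hne hm Q hQ hN⟩
  have h := hsep Z hZ L hdeg x r hcurve σ (fun Q hQ => ?_)
  · exact (by exact_mod_cast hk₂ : ((2 : ℝ) ^ k₂)⁻¹ ≤ c₀).trans h
  · calc ρ ≤ ‖σ x - Q.1‖ := (hfar σ Q.1 hQ.2).le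
      _ = dist (σ x) Q.1 := (dist_eq_norm _ _).symm
      _ ≤ dist (σ x, σ r) Q := by rw [Prod.dist_eq]; exact le_max_left _ _

/-- **`harch`.** For the mechanism `(c, p, q)` with `p·q·(p−q)` vanishing on the critical values and every
`ρ > 0`, there is `C₃` such that for every number field `L`, every point `(x, r)` of `D_e(L)` all of whose
complex conjugates of `x` are `ρ`-far from the complex roots of `g`, and every infinite place `v` of `L`:
`log⁺ (v (N_c(x,r))⁻¹) ≤ C₃` (abc-iut-w5-d027's archimedean separation lemma; no degree bound).
[cite: MochizukiGenEll2010, Thm 2.1 proof p.12] -/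
theorem exists_C3_of_far_aroots_arch (k : ℕ) {c : ℚ} (hc : c ≠ 0) {p q : ℚ[X]}
    (hp0 : p ≠ 0) (hq0 : q ≠ 0) (hne : p ≠ q)
    (hm : ∀ a ∈ DeCrit.critSetC k c, aeval a (p * q * (p - q)) = 0) {ρ : ℝ} (hρ : 0 < ρ) :
    ∃ C₃ : ℝ, ∀ (L : Type) [Field L] [NumberField L] (x r : L), r ^ (2 * k + 1) = x * (1 - x) →
      (∀ σ : L →+* ℂ, ∀ a ∈ (resultant (De.curvePoly k)
        (De.homFibrePolyC k c (p * q * (p - q)))).aroots ℂ, ρ < ‖σ x - a‖) →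
      ∀ v : InfinitePlace L,
        Real.posLog
            (v (-(1 - 2 * x) ^ 3 + (c : L) * (((k : L) + 1) * r ^ (k + 2) - 2 * r ^ (3 * k + 3)))⁻¹)
          ≤ C₃ := by
  have hcℂ : ((c : ℂ)) ≠ 0 := Rat.cast_ne_zero.mpr hc
  obtain ⟨δ, hδ, hsep⟩ := exists_pos_le_norm_N_of_fst_separated k hcℂ hρ
  refine ⟨Real.posLog δ⁻¹, fun L _ _ x r hcurve hfar v => ?_⟩
  set Nx : L := -(1 - 2 * x) ^ 3 + (c : L) * (((k : L) + 1) * r ^ (k + 2) - 2 * r ^ (3 * k + 3)) with hNx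
  let σ : L →+* ℂ := v.embedding
  let X : Set ℂ :=
    {a | a ∈ (resultant (De.curvePoly k) (De.homFibrePolyC k c (p * q * (p - q)))).aroots ℂ}
  have hX : ∀ Q ∈ DeArch.curve ℂ k, N k (c : ℂ) Q = 0 → Q.1 ∈ X :=
    fun Q hQ hN => fst_mem_aroots_resultant_of_N_eq_zero k hc hp0 hq0 hne hm Q hQ hN
  have hP : (σ x, σ r) ∈ DeArch.curve ℂ k := by
    change (σ r) ^ (2 * k + 1) = σ x * (1 - σ x)
    rw [← map_pow, hcurve, map_mul, map_sub, map_one]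
  have hδN : δ ≤ ‖N k (c : ℂ) (σ x, σ r)‖ :=
    hsep X hX (σ x, σ r) hP (fun a ha => (hfar σ a ha).le)
  have hσN : σ Nx = N k (c : ℂ) (σ x, σ r) := by
    simp [hNx, N, map_add, map_sub, map_neg, map_mul, map_pow, map_natCast, map_ofNat, map_one,
      map_ratCast]
  have hvN : v Nx = ‖N k (c : ℂ) (σ x, σ r)‖ := by
    rw [← hσN]; exact (InfinitePlace.norm_embedding_eq v Nx).symm
  have hNpos : 0 < v Nx := by rw [hvN]; exact hδ.trans_le hδN
  rw [map_inv₀]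
  refine Real.posLog_le_posLog (inv_nonneg.mpr (le_of_lt hNpos)) ?_
  rw [hvN]
  exact inv_anti₀ hδ hδN

end Separation

end DeFamily

end Literature.NumberTheory.DiophantineGeometry.GenEll

end
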